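import Summits.CriticalPhenomena.SAWScalingLimit.Theorems.SAWTotalPositivityCriticalBubbleBoundKestenColumnMassLeOne
import Literature.Probability.RandomPlanarGeometry.SAWWordBridges
import HarnessLib

/-!
# Line `kesten-product-renewal-dictionary` (crux stmt-CriticalPhenomena-7117): stub R2 — Kesten's
renewal density `u_h` is literally a renewal sequence

Proof file for the registered stub `columnMass_renewal_of` of the line
`kesten-product-renewal-dictionary` for the crux `SAWTotalPositivity.CriticalBubbleBound`.

The line's renewal density (`Theorems/SAWTotalPositivityCriticalBubbleBoundKestenDefs.lean`,
Madras–Slade §4.2) is `u_h = columnMass h = Σ'_{W : Bridge, span W = h} x_c^{|W|}`, a sum over the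
VERTEX-FUNCTION bridges `Bridge = Σ n, Zd.bridges 2 n` of `ℤ²` from the origin.

HYPOTHESIS (stub R1 of the line, proved in the WORD model of `SAWWords.lean` / `SAWWordBridges.lean`,
Kesten's renewal equation, Madras–Slade (4.2.2) at `z = x_c`): for every `L ≥ 1`,
`U(L) = Σ_{j=1}^{L} Λ(j) U(L-j)`, where `U(L) = Σ'_{w self-avoiding bridge word, span w = L} x_c^{|w|}`
and `Λ(j) = Σ'_{s irreducible bridge word, span s = j} x_c^{|s|}`.

CONCLUSION (this file):
* (a) `u_h = U(h)` for every `h` (`columnMass_eq_tsum_bridgeWords`): the self-avoiding bridge words of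
  span `h` and the vertex-function bridges of span `h` are in bijection by `w ↦ (|w|, traj w)` /
  `W ↦ wordOf |W| W` (`traj_mem_bridges`, `traj_wordOf`, `eq_of_traj_eq`), a bijection preserving the
  length, hence the critical weight; the two `tsum`s agree by `Equiv.tsum_eq`.
* (b) the renewal equation for `u_h`: `u_h = Σ_{j=1}^{h} Λ(j) u_{h-j}` for `h ≥ 1` (rewrite (a) in R1).

Sources: N. Madras, G. Slade, *The Self-Avoiding Walk* (1993), Definition 1.2.4 (bridges), §1.1 (words
versus vertex functions), §4.2 (Kesten's renewal structure, eq. (4.2.2)); H. Kesten, *On the number of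
self-avoiding walks*, J. Math. Phys. 4 (1963), §4. Deliberately NOT here: the renewal equation R1 itself
(another file of the line) and Kesten's identity `Σ_j Λ(j) = 1`.
-/

noncomputable section

open Literature.Probability.LatticeModels
open Literature.Probability.RandomPlanarGeometry Literature.Probability.RandomPlanarGeometry.SAW
open scoped ENNReal NNReal BigOperators
open Classical

namespace Summit.CriticalPhenomena.SAWScalingLimit.Theorems.CriticalBubbleBound.Kesten.HW

/-! ## `u_h` as a sum over the bridges of span `h` -/

/-- `u_h = Σ'_{W : Bridge, span W = h} x_c^{|W|}`, written as a `tsum` over the subtype of the bridges of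
span `h` (rather than with an indicator over all bridges). [folklore] -/
theorem columnMass_eq_tsum_spanSubtype (h : ℕ) :
    columnMass h = ∑' W : {W : Bridge // W.span = (h : ℤ)}, W.1.mass := by
  have key := tsum_subtype (f := fun W : Bridge => W.mass) {W : Bridge | W.span = (h : ℤ)}
  simp only [Set.indicator_apply, Set.mem_setOf_eq] at key
  rw [columnMass]
  exact key.symm

/-! ## Bridge words versus bridge vertex functions -/

/-- The step word read off a vertex-function bridge `ω ∈ Zd.bridges 2 n` is a self-avoiding bridge
word (of length `n`) with the same span `ω₁(n)`. [cite: MadrasSlade1993, Definition 1.2.4] -/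
theorem wordOf_fn_spec {n : ℕ} {ω : ℕ → Site 2} (hω : ω ∈ Zd.bridges 2 n) :
    IsSAW (wordOf n ω) ∧ IsBridgeW (wordOf n ω) ∧ xEnd (wordOf n ω) = ω n 0 := by
  rw [Zd.mem_bridges] at hω
  obtain ⟨hω, hb⟩ := hω
  refine ⟨?_, ?_, ?_⟩
  · rw [isSAW_iff_injOn, traj_wordOf hω, length_wordOf]
    exact (Zd.mem_saws.1 hω).2.2.2
  · show Zd.IsBridge (wordOf n ω).length (traj (wordOf n ω))
    rw [length_wordOf, traj_wordOf hω]
    exact hb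
  · show traj (wordOf n ω) (wordOf n ω).length 0 = ω n 0
    rw [length_wordOf, traj_wordOf hω]

/-- Reading off the step word of the trajectory of a self-avoiding word gives the word back
(`wordOf` inverts `traj` on words of the right length). [folklore] -/
theorem wordOf_length_traj {w : List Step} (hs : IsSAW w) : wordOf w.length (traj w) = w :=
  eq_of_traj_eq (length_wordOf _ _) (traj_wordOf (traj_mem_saws rfl hs))

/-! ## (a) `u_h` in the word model -/

/-- **`u_h = U(h)`.** Kesten's renewal density equals the critical mass of the self-avoiding bridge
WORDS of span `h`: `columnMass h = Σ'_{w : IsSAW w, IsBridgeW w, xEnd w = h} x_c^{|w|}`. The bridge words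
of span `h` and the vertex-function bridges of span `h` are in bijection by `w ↦ (|w|, traj w)`,
`W ↦ wordOf |W| W`, a bijection preserving the length. [cite: MadrasSlade1993, §1.1, Definition 1.2.4] -/
theorem columnMass_eq_tsum_bridgeWords (h : ℕ) :
    columnMass h = ∑' w : {w : List Step // IsSAW w ∧ IsBridgeW w ∧ xEnd w = (h : ℤ)},
      ENNReal.ofReal (criticalFugacity ^ w.1.length) := by
  rw [columnMass_eq_tsum_spanSubtype]
  -- the length-preserving bijection between bridge words of span `h` and bridges of span `h`
  let e : {w : List Step // IsSAW w ∧ IsBridgeW w ∧ xEnd w = (h : ℤ)} ≃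
      {W : Bridge // W.span = (h : ℤ)} :=
    { toFun := fun w => ⟨⟨w.1.length, ⟨traj w.1, traj_mem_bridges rfl w.2.1 w.2.2.1⟩⟩, w.2.2.2⟩
      invFun := fun W => ⟨wordOf W.1.len W.1.fn, (wordOf_fn_spec W.1.2.2).1,
        (wordOf_fn_spec W.1.2.2).2.1, (wordOf_fn_spec W.1.2.2).2.2.trans W.2⟩
      left_inv := fun w => Subtype.ext (wordOf_length_traj w.2.1)
      right_inv := fun W => Subtype.ext
        (Sigma.subtype_ext (length_wordOf _ _) (traj_wordOf W.1.mem_saws_isBridge.1)) }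
  exact (e.tsum_eq fun W => W.1.mass).symm

/-! ## The registered stub: (a) and (b) the renewal equation for `u_h` -/

/-- **Stub R2 of the line `kesten-product-renewal-dictionary`** (registered signature, verbatim). From
the word-model renewal equation `U(L) = Σ_{j=1}^{L} Λ(j) U(L-j)` (`L ≥ 1`, stub R1; `U(L)` the critical
mass of the self-avoiding bridge words of span `L`, `Λ(j)` that of the irreducible bridge words of span
`j`) it follows that (a) `u_h = columnMass h = U(h)` for all `h` (bridge words and vertex-function bridges
of the same span are in length-preserving bijection) and (b) Kesten's renewal density satisfies the
renewal equation `u_h = Σ_{j=1}^{h} Λ(j) u_{h-j}` for `h ≥ 1`: `u_h` is literally a renewal sequence.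
[cite: MadrasSlade1993, §4.2, eq. (4.2.2)] -/
theorem columnMass_renewal_of : (∀ L : ℕ, 1 ≤ L → (∑' w : {w : List Step // IsSAW w ∧ IsBridgeW w ∧ xEnd w = (L : ℤ)}, ENNReal.ofReal (criticalFugacity ^ w.1.length)) = ∑ j ∈ Finset.Icc 1 L, (∑' s : {s : List Step // IsIrrBridge s ∧ xEnd s = (j : ℤ)}, ENNReal.ofReal (criticalFugacity ^ s.1.length)) * (∑' w : {w : List Step // IsSAW w ∧ IsBridgeW w ∧ xEnd w = ((L - j : ℕ) : ℤ)}, ENNReal.ofReal (criticalFugacity ^ w.1.length))) → (∀ h : ℕ, columnMass h = ∑' w : {w : List Step // IsSAW w ∧ IsBridgeW w ∧ xEnd w = (h : ℤ)}, ENNReal.ofReal (criticalFugacity ^ w.1.length)) ∧ (∀ h : ℕ, 1 ≤ h → columnMass h = ∑ j ∈ Finset.Icc 1 h, (∑' s : {s : List Step // IsIrrBridge s ∧ xEnd s = (j : ℤ)}, ENNReal.ofReal (criticalFugacity ^ s.1.length)) * columnMass (h - j)) := by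
  intro hren
  refine ⟨columnMass_eq_tsum_bridgeWords, fun h hh => ?_⟩
  rw [columnMass_eq_tsum_bridgeWords h, hren h hh]
  exact Finset.sum_congr rfl fun j _ => by rw [columnMass_eq_tsum_bridgeWords (h - j)]

end Summit.CriticalPhenomena.SAWScalingLimit.Theorems.CriticalBubbleBound.Kesten.HW

end
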